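import Mathlib
import HarnessLib
import Literature.Analysis.FluidPDE.HardSphereFlowJointMeasurable
import Summits.AtomisticToContinuum.HydrodynamicLimit.Theses.AntiMazurCoboundaries

/-!
# The L² anti-Mazur certificate (route `AntiMazurCoboundaries`, item stmt-AtomisticToContinuum-14138)

For a hard-sphere flow `Φ` on `𝕋³`, a probability law `μ` on phase space that is invariant under every
`Φ_t` and carried by the good set, bounded measurable observables `F`, `W`, a window `h > 0` and a lag
`lag > 0`:

`∫ (h⁻¹ ∫₀ʰ F(Φ_s z) ds)² dμ ≤ 2 ∫ (F − lag⁻¹ (W ∘ Φ_lag − W))² dμ + 8 ∫ (h⁻¹ W)² dμ`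

(all three integrals as lower Lebesgue integrals of `ENNReal.ofReal` of squares, exactly as typed in
`Summit.AtomisticToContinuum.HydrodynamicLimit.Theses.AntiMazurCoboundaries.VarianceCertificate`).
This is the finite-lag, finite-volume form of the range-side bound `D(A) ≤ ‖A − L w‖²` dual to Mazur's
inequality (Mazur 1969; Suzuki 1971): coboundaries `lag⁻¹ (W ∘ Φ_lag − W)` have small time averages,
so subtracting one from `F` costs only the `8 ∫ (h⁻¹ W)²` term.

Proof (pathwise telescoping + Jensen + invariance). On the good set, with
`G := F − lag⁻¹ (W ∘ Φ_lag − W)` and the group law `Φ_lag ∘ Φ_s = Φ_{s+lag}`,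
`∫₀ʰ F∘Φ_s ds = ∫₀ʰ G∘Φ_s ds + lag⁻¹ (∫ₕ^{h+lag} W∘Φ_u du − ∫₀^{lag} W∘Φ_u du)`;
then `(x + y)² ≤ 2x² + 2y²`, `(P − Q)² ≤ 2P² + 2Q²`, Cauchy–Schwarz on each window
(`(∫ₐᵇ f)² ≤ (b − a) ∫ₐᵇ f²`), and finally Tonelli on `[a, b] × μ` (joint measurability of the flow on
the good set, `HardSphereFlow.measurable_flow_prod_torus`) with invariance of `μ` slice by slice:
`∫ (∫ₐᵇ g(Φ_u z) du) dμ = (b − a) ∫ g dμ`. The constants come out exactly `2` and `8`.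

References: P. Mazur, Physica 43 (1969) 533–545; M. Suzuki, Physica 51 (1971) 277–291.
-/

noncomputable section

open MeasureTheory Set Filter
open scoped ENNReal

namespace Summit.AtomisticToContinuum.HydrodynamicLimit.Theorems

open Literature.Analysis.FluidPDE Literature.MathematicalPhysics.KineticTheory

namespace AntiMazurCoboundariesVarianceCertificate

/-! ## Two real-variable lemmas -/

/-- Cauchy–Schwarz on a window: `(∫ₐᵇ f)² ≤ (b − a) ∫ₐᵇ f²` for an interval-integrable `f` with
interval-integrable square (discriminant of `t ↦ ∫ₐᵇ (t + f)² ≥ 0`). [folklore] -/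
theorem sq_integral_le_mul_integral_sq {f : ℝ → ℝ} {a b : ℝ} (hab : a ≤ b)
    (hi : IntervalIntegrable f volume a b)
    (hi2 : IntervalIntegrable (fun x => f x ^ 2) volume a b) :
    (∫ x in a..b, f x) ^ 2 ≤ (b - a) * ∫ x in a..b, f x ^ 2 := by
  have hq : ∀ t : ℝ,
      0 ≤ (b - a) * (t * t) + (2 * ∫ x in a..b, f x) * t + ∫ x in a..b, f x ^ 2 := by
    intro t
    have : (b - a) * (t * t) + (2 * ∫ x in a..b, f x) * t + ∫ x in a..b, f x ^ 2 =
        ∫ x in a..b, (t + f x) ^ 2 := by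
      rw [← intervalIntegral.integral_const_mul, ← intervalIntegral.integral_mul_const]
      have h1 : (b - a) * (t * t) = ∫ _ in a..b, t * t := by
        rw [intervalIntegral.integral_const, smul_eq_mul]
      rw [h1, ← intervalIntegral.integral_add intervalIntegrable_const
          (hi.const_mul _ |>.mul_const _),
        ← intervalIntegral.integral_add
          (intervalIntegrable_const.add (hi.const_mul _ |>.mul_const _)) hi2]
      refine intervalIntegral.integral_congr fun x _ => ?_
      ring
    rw [this]
    exact intervalIntegral.integral_nonneg hab fun x _ => sq_nonneg _
  have hd := discrim_le_zero hq
  rw [discrim] at hd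
  nlinarith

/-- A measurable function bounded in absolute value is interval integrable on every window. [folklore] -/
theorem intervalIntegrable_of_abs_le {f : ℝ → ℝ} (hf : Measurable f) {C : ℝ}
    (hC : ∀ s, |f s| ≤ C) (a b : ℝ) : IntervalIntegrable f volume a b :=
  (intervalIntegrable_const (c := C)).mono_fun' hf.aestronglyMeasurable
    (Eventually.of_forall fun s => by simpa [Real.norm_eq_abs] using hC s)

/-! ## Orbits of good points and time averages -/

variable {N : ℕ} {ε : ℝ}

/-- The orbit `s ↦ Φ_s z` of a good point of a hard-sphere flow on `𝕋³` is measurable in time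
(joint measurability of the flow on the good set, `HardSphereFlow.measurable_flow_prod_torus`). [folklore] -/
theorem measurable_orbit (Φ : HardSphereFlow (Torus.geometry (Fin 3)) ε N)
    {z : Config N (Fin 3) T3} (hz : z ∈ Φ.good) : Measurable fun s : ℝ => Φ.flow s z := by
  have h1 : Measurable fun s : ℝ => ((⟨z, hz⟩ : Φ.good), s) := measurable_const.prodMk measurable_id
  exact Φ.measurable_flow_prod_torus.comp h1

/-- A bounded measurable observable evaluated along a good orbit is interval integrable. [folklore] -/
theorem intervalIntegrable_comp_orbit (Φ : HardSphereFlow (Torus.geometry (Fin 3)) ε N)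
    {z : Config N (Fin 3) T3} (hz : z ∈ Φ.good) {g : Config N (Fin 3) T3 → ℝ} (hg : Measurable g)
    {C : ℝ} (hC : ∀ w, |g w| ≤ C) (a b : ℝ) :
    IntervalIntegrable (fun s => g (Φ.flow s z)) volume a b :=
  intervalIntegrable_of_abs_le (hg.comp (measurable_orbit Φ hz)) (fun _ => hC _) a b

/-- Joint a.e.-measurability of `(s, z) ↦ Φ_s z` on `ν ⊗ μ` for every s-finite `ν` on `ℝ` and every
s-finite `μ` on phase space carried by the good set (modify the flow off the good set). [folklore] -/
theorem aemeasurable_flow_prod (Φ : HardSphereFlow (Torus.geometry (Fin 3)) ε N)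
    (ν : Measure ℝ) [SFinite ν] (μ : Measure (Config N (Fin 3) T3)) [SFinite μ]
    (hμ : μ Φ.goodᶜ = 0) :
    AEMeasurable (fun p : ℝ × Config N (Fin 3) T3 => Φ.flow p.1 p.2) (ν.prod μ) := by
  classical
  set s : Set (ℝ × Config N (Fin 3) T3) := Prod.snd ⁻¹' Φ.good with hs_def
  have hs : MeasurableSet s := measurable_snd Φ.measurableSet_good
  have hf : Measurable fun q : s =>
      Φ.flow (q : ℝ × Config N (Fin 3) T3).1
        (((⟨(q : ℝ × Config N (Fin 3) T3).2, q.2⟩ : Φ.good)) : Config N (Fin 3) T3) := by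
    have h1 : Measurable fun q : s =>
        (((⟨(q : ℝ × Config N (Fin 3) T3).2, q.2⟩ : Φ.good)), (q : ℝ × Config N (Fin 3) T3).1) :=
      ((measurable_snd.comp measurable_subtype_coe).subtype_mk).prodMk
        (measurable_fst.comp measurable_subtype_coe)
    exact Φ.measurable_flow_prod_torus.comp h1
  refine ⟨fun p => if hp : p ∈ s then
      Φ.flow p.1 (((⟨p.2, hp⟩ : Φ.good)) : Config N (Fin 3) T3) else p.2, ?_, ?_⟩
  · exact Measurable.dite hf (measurable_snd.comp measurable_subtype_coe) hs
  · have hae : ∀ᵐ z ∂μ, z ∈ Φ.good := mem_ae_iff.2 hμ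
    have hae' : ∀ᵐ p ∂(ν.prod μ), p.2 ∈ Φ.good :=
      (Measure.quasiMeasurePreserving_snd (μ := ν) (ν := μ)).ae hae
    filter_upwards [hae'] with p hp
    have hp' : p ∈ s := hp
    simp only [hp', dif_pos]

/-- **Time averages have stationary expectation (Tonelli + invariance).** For a nonnegative bounded
measurable observable `g`, a law `μ` invariant under every `Φ_t` and carried by the good set, and a
window `a ≤ b`: `∫ (∫ₐᵇ g(Φ_u z) du) dμ = (b − a) ∫ g dμ` (as lower Lebesgue integrals). [folklore] -/
theorem lintegral_ofReal_window (Φ : HardSphereFlow (Torus.geometry (Fin 3)) ε N)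
    (μ : Measure (Config N (Fin 3) T3)) [SFinite μ]
    (hinv : ∀ t, MeasurePreserving (Φ.flow t) μ μ) (hgood : μ Φ.goodᶜ = 0)
    {g : Config N (Fin 3) T3 → ℝ} (hg : Measurable g) (hg0 : ∀ w, 0 ≤ g w)
    {C : ℝ} (hC : ∀ w, |g w| ≤ C) {a b : ℝ} (hab : a ≤ b) :
    ∫⁻ z, ENNReal.ofReal (∫ s in a..b, g (Φ.flow s z)) ∂μ =
      ENNReal.ofReal (b - a) * ∫⁻ z, ENNReal.ofReal (g z) ∂μ := by
  -- the inner interval integral as a lower integral, a.e. (on the good set)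
  have hae : ∀ᵐ z ∂μ, z ∈ Φ.good := mem_ae_iff.2 hgood
  have h1 : ∀ᵐ z ∂μ, ENNReal.ofReal (∫ s in a..b, g (Φ.flow s z)) =
      ∫⁻ s, ENNReal.ofReal (g (Φ.flow s z)) ∂(volume.restrict (Ioc a b)) := by
    filter_upwards [hae] with z hz
    rw [intervalIntegral.integral_of_le hab]
    exact ofReal_integral_eq_lintegral_ofReal (intervalIntegrable_comp_orbit Φ hz hg hC a b).1
      (Eventually.of_forall fun s => hg0 _)
  rw [lintegral_congr_ae h1]
  -- Tonelli
  have hflow := aemeasurable_flow_prod Φ (volume.restrict (Ioc a b)) μ hgood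
  have hF : AEMeasurable (fun p : ℝ × Config N (Fin 3) T3 => ENNReal.ofReal (g (Φ.flow p.1 p.2)))
      ((volume.restrict (Ioc a b)).prod μ) :=
    (hg.comp_aemeasurable hflow).ennreal_ofReal
  have hswap : (∫⁻ z, ∫⁻ s, ENNReal.ofReal (g (Φ.flow s z)) ∂(volume.restrict (Ioc a b)) ∂μ) =
      ∫⁻ s, ∫⁻ z, ENNReal.ofReal (g (Φ.flow s z)) ∂μ ∂(volume.restrict (Ioc a b)) :=
    (lintegral_prod_symm _ hF).symm.trans (lintegral_prod _ hF)
  rw [hswap]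
  -- invariance, slice by slice
  have hslice : ∀ s, ∫⁻ z, ENNReal.ofReal (g (Φ.flow s z)) ∂μ = ∫⁻ z, ENNReal.ofReal (g z) ∂μ :=
    fun s => (hinv s).lintegral_comp hg.ennreal_ofReal
  simp only [hslice, lintegral_const, Measure.restrict_apply_univ, Real.volume_Ioc]
  rw [mul_comm]

/-- **Pathwise telescoping on the good set.** With `G := F − lag⁻¹ (W ∘ Φ_lag − W)` and the group law
`Φ_lag (Φ_s z) = Φ_{s+lag} z`:
`∫₀ʰ F(Φ_s z) ds = ∫₀ʰ G(Φ_s z) ds + lag⁻¹ (∫ₕ^{h+lag} W(Φ_u z) du − ∫₀^{lag} W(Φ_u z) du)`. [folklore] -/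
theorem window_telescope (Φ : HardSphereFlow (Torus.geometry (Fin 3)) ε N)
    {z : Config N (Fin 3) T3} (hz : z ∈ Φ.good) {F W : Config N (Fin 3) T3 → ℝ}
    (hF : Measurable F) (hW : Measurable W) {CF CW : ℝ} (hCF : ∀ w, |F w| ≤ CF)
    (hCW : ∀ w, |W w| ≤ CW) (h lag : ℝ) :
    ∫ s in (0 : ℝ)..h, F (Φ.flow s z) =
      (∫ s in (0 : ℝ)..h,
          (F (Φ.flow s z) - lag⁻¹ * (W (Φ.flow lag (Φ.flow s z)) - W (Φ.flow s z)))) +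
        lag⁻¹ * ((∫ s in h..h + lag, W (Φ.flow s z)) - ∫ s in (0 : ℝ)..lag, W (Φ.flow s z)) := by
  have hWo : ∀ a b : ℝ, IntervalIntegrable (fun s => W (Φ.flow s z)) volume a b :=
    intervalIntegrable_comp_orbit Φ hz hW hCW
  have hFo : ∀ a b : ℝ, IntervalIntegrable (fun s => F (Φ.flow s z)) volume a b :=
    intervalIntegrable_comp_orbit Φ hz hF hCF
  have hshift : ∀ s : ℝ, W (Φ.flow lag (Φ.flow s z)) = W (Φ.flow (s + lag) z) := by
    intro s
    rw [← Φ.flow_add lag s z hz, add_comm]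
  have hWs : ∀ a b : ℝ, IntervalIntegrable (fun s => W (Φ.flow (s + lag) z)) volume a b :=
    fun a b => intervalIntegrable_of_abs_le
      (hW.comp ((measurable_orbit Φ hz).comp (measurable_id.add_const lag))) (fun _ => hCW _) a b
  simp only [hshift]
  rw [intervalIntegral.integral_sub (hFo 0 h) (((hWs 0 h).sub (hWo 0 h)).const_mul _),
    intervalIntegral.integral_const_mul, intervalIntegral.integral_sub (hWs 0 h) (hWo 0 h),
    intervalIntegral.integral_comp_add_right (fun s => W (Φ.flow s z)) lag, zero_add]
  have hadd1 := intervalIntegral.integral_add_adjacent_intervals (hWo 0 lag) (hWo lag (h + lag))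
  have hadd2 := intervalIntegral.integral_add_adjacent_intervals (hWo 0 h) (hWo h (h + lag))
  linear_combination lag⁻¹ * hadd1 - lag⁻¹ * hadd2

end AntiMazurCoboundariesVarianceCertificate

open AntiMazurCoboundariesVarianceCertificate in
/-- **The L² anti-Mazur certificate** (item stmt-AtomisticToContinuum-14138, route
`AntiMazurCoboundaries`, decl `VarianceCertificate`): for a hard-sphere flow `Φ` on `𝕋³`, a
probability law `μ` invariant under every `Φ_t` with `μ(goodᶜ) = 0`, bounded measurable `F`, `W`,
`h > 0`, `lag > 0`,
`∫ (h⁻¹∫₀ʰ F∘Φ_s ds)² dμ ≤ 2 ∫ (F − lag⁻¹(W∘Φ_lag − W))² dμ + 8 ∫ (h⁻¹ W)² dμ`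
(pathwise telescoping, `(x+y)² ≤ 2x²+2y²`, Cauchy–Schwarz in time, Tonelli and invariance; the
finite-lag, finite-volume form of `D(A) ≤ ‖A − Lw‖²`, Mazur 1969 / Suzuki 1971). [folklore] -/
theorem antiMazurCoboundaries_varianceCertificate_proof :
    Summit.AtomisticToContinuum.HydrodynamicLimit.Theses.AntiMazurCoboundaries.VarianceCertificate := by
  intro ε N Φ μ hμ hinv hgood F W hF hW hbF hbW h lag hh hlag
  obtain ⟨CF, hCF⟩ := hbF
  obtain ⟨CW, hCW⟩ := hbW
  have hh0 : h ≠ 0 := hh.ne'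
  have hl0 : lag ≠ 0 := hlag.ne'
  have hinvh : h⁻¹ * h = 1 := inv_mul_cancel₀ hh0
  have hinvl : lag⁻¹ * lag = 1 := inv_mul_cancel₀ hl0
  -- the defect observable `G = F − lag⁻¹ (W ∘ Φ_lag − W)` and its bounds
  set G : Config (N + 1) (Fin 3) T3 → ℝ := fun w => F w - lag⁻¹ * (W (Φ.flow lag w) - W w) with hG
  have hGm : Measurable G :=
    hF.sub ((((hW.comp (Φ.measurable_flow lag)).sub hW)).const_mul _)
  have hCG : ∀ w, |G w| ≤ CF + |lag⁻¹| * (CW + CW) := by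
    intro w
    calc |G w| ≤ |F w| + |lag⁻¹ * (W (Φ.flow lag w) - W w)| := abs_sub _ _
      _ = |F w| + |lag⁻¹| * |W (Φ.flow lag w) - W w| := by rw [abs_mul]
      _ ≤ CF + |lag⁻¹| * (CW + CW) := by
        gcongr
        · exact hCF w
        · exact (abs_sub _ _).trans (add_le_add (hCW _) (hCW _))
  have hG2m : Measurable fun w => G w ^ 2 := hGm.pow_const 2
  have hW2m : Measurable fun w => W w ^ 2 := hW.pow_const 2
  have hCG2 : ∀ w, |G w ^ 2| ≤ (CF + |lag⁻¹| * (CW + CW)) ^ 2 := fun w => by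
    rw [abs_pow]; exact pow_le_pow_left₀ (abs_nonneg _) (hCG w) 2
  have hCW2 : ∀ w, |W w ^ 2| ≤ CW ^ 2 := fun w => by
    rw [abs_pow]; exact pow_le_pow_left₀ (abs_nonneg _) (hCW w) 2
  -- the pointwise bound on the good set
  set c : ℝ := 4 * h⁻¹ ^ 2 * lag⁻¹ with hc
  have hc0 : 0 ≤ c := by positivity
  have hae : ∀ᵐ z ∂μ, z ∈ Φ.good := mem_ae_iff.2 hgood
  have hpt : ∀ᵐ z ∂μ, ENNReal.ofReal ((h⁻¹ * ∫ s in (0 : ℝ)..h, F (Φ.flow s z)) ^ 2) ≤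
      ENNReal.ofReal (2 * h⁻¹) * ENNReal.ofReal (∫ s in (0 : ℝ)..h, G (Φ.flow s z) ^ 2) +
        ENNReal.ofReal c * ENNReal.ofReal (∫ s in h..h + lag, W (Φ.flow s z) ^ 2) +
        ENNReal.ofReal c * ENNReal.ofReal (∫ s in (0 : ℝ)..lag, W (Φ.flow s z) ^ 2) := by
    filter_upwards [hae] with z hz
    -- the four windows
    have hA := window_telescope Φ hz hF hW hCF hCW h lag
    have eX := sq_integral_le_mul_integral_sq hh.le
      (intervalIntegrable_comp_orbit Φ hz hGm hCG 0 h)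
      (intervalIntegrable_comp_orbit Φ hz hG2m hCG2 0 h)
    have eP := sq_integral_le_mul_integral_sq (by linarith : h ≤ h + lag)
      (intervalIntegrable_comp_orbit Φ hz hW hCW h (h + lag))
      (intervalIntegrable_comp_orbit Φ hz hW2m hCW2 h (h + lag))
    have eQ := sq_integral_le_mul_integral_sq hlag.le
      (intervalIntegrable_comp_orbit Φ hz hW hCW 0 lag)
      (intervalIntegrable_comp_orbit Φ hz hW2m hCW2 0 lag)
    rw [sub_zero] at eX eQ
    rw [add_sub_cancel_left] at eP
    simp only [hG] at eX ⊢
    set X := ∫ s in (0 : ℝ)..h, (F (Φ.flow s z) - lag⁻¹ * (W (Φ.flow lag (Φ.flow s z)) - W (Φ.flow s z)))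
    set P := ∫ s in h..h + lag, W (Φ.flow s z)
    set Q := ∫ s in (0 : ℝ)..lag, W (Φ.flow s z)
    set JG := ∫ s in (0 : ℝ)..h,
      (F (Φ.flow s z) - lag⁻¹ * (W (Φ.flow lag (Φ.flow s z)) - W (Φ.flow s z))) ^ 2
    set JP := ∫ s in h..h + lag, W (Φ.flow s z) ^ 2
    set JQ := ∫ s in (0 : ℝ)..lag, W (Φ.flow s z) ^ 2
    have e1a : (X + lag⁻¹ * (P - Q)) ^ 2 ≤ 2 * X ^ 2 + 2 * (lag⁻¹ * (P - Q)) ^ 2 := by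
      nlinarith [sq_nonneg (X - lag⁻¹ * (P - Q))]
    have e1b : (lag⁻¹ * (P - Q)) ^ 2 ≤ lag⁻¹ ^ 2 * (2 * (P ^ 2 + Q ^ 2)) := by
      rw [mul_pow]
      refine mul_le_mul_of_nonneg_left ?_ (sq_nonneg _)
      nlinarith [sq_nonneg (P + Q)]
    have hreal : (h⁻¹ * ∫ s in (0 : ℝ)..h, F (Φ.flow s z)) ^ 2 ≤
        2 * h⁻¹ * JG + c * JP + c * JQ := by
      calc (h⁻¹ * ∫ s in (0 : ℝ)..h, F (Φ.flow s z)) ^ 2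
          = h⁻¹ ^ 2 * (X + lag⁻¹ * (P - Q)) ^ 2 := by rw [hA, mul_pow]
        _ ≤ h⁻¹ ^ 2 * (2 * X ^ 2 + 2 * (lag⁻¹ ^ 2 * (2 * (P ^ 2 + Q ^ 2)))) := by
          gcongr
          exact e1a.trans (by linarith)
        _ ≤ h⁻¹ ^ 2 * (2 * (h * JG) + 2 * (lag⁻¹ ^ 2 * (2 * (lag * JP + lag * JQ)))) := by
          gcongr
        _ = 2 * h⁻¹ * JG + c * JP + c * JQ := by
          simp only [hc]
          linear_combination (2 * h⁻¹ * JG) * hinvh + (4 * h⁻¹ ^ 2 * lag⁻¹ * (JP + JQ)) * hinvl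
    calc ENNReal.ofReal ((h⁻¹ * ∫ s in (0 : ℝ)..h, F (Φ.flow s z)) ^ 2)
        ≤ ENNReal.ofReal (2 * h⁻¹ * JG + c * JP + c * JQ) := ENNReal.ofReal_le_ofReal hreal
      _ ≤ ENNReal.ofReal (2 * h⁻¹ * JG + c * JP) + ENNReal.ofReal (c * JQ) := ENNReal.ofReal_add_le
      _ ≤ ENNReal.ofReal (2 * h⁻¹ * JG) + ENNReal.ofReal (c * JP) + ENNReal.ofReal (c * JQ) := by
          gcongr
          exact ENNReal.ofReal_add_le
      _ = _ := by
          rw [ENNReal.ofReal_mul (by positivity : (0 : ℝ) ≤ 2 * h⁻¹), ENNReal.ofReal_mul hc0,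
            ENNReal.ofReal_mul hc0]
  -- a.e.-measurability of the three window functionals
  have hmG : AEMeasurable (fun z => ENNReal.ofReal (∫ s in (0 : ℝ)..h, G (Φ.flow s z) ^ 2)) μ :=
    (Φ.aemeasurable_intervalIntegral_comp_flow_torus hG2m 0 h hgood).ennreal_ofReal
  have hmP : AEMeasurable
      (fun z => ENNReal.ofReal (∫ s in h..h + lag, W (Φ.flow s z) ^ 2)) μ :=
    (Φ.aemeasurable_intervalIntegral_comp_flow_torus hW2m h (h + lag) hgood).ennreal_ofReal
  have hm12 : AEMeasurable (fun z =>
      ENNReal.ofReal (2 * h⁻¹) * ENNReal.ofReal (∫ s in (0 : ℝ)..h, G (Φ.flow s z) ^ 2) +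
        ENNReal.ofReal c * ENNReal.ofReal (∫ s in h..h + lag, W (Φ.flow s z) ^ 2)) μ :=
    (hmG.const_mul _).add (hmP.const_mul _)
  -- the three stationary time averages
  have wG := lintegral_ofReal_window Φ μ hinv hgood hG2m (fun w => sq_nonneg _) hCG2 hh.le
  have wP := lintegral_ofReal_window Φ μ hinv hgood hW2m (fun w => sq_nonneg _) hCW2
    (by linarith : h ≤ h + lag)
  have wQ := lintegral_ofReal_window Φ μ hinv hgood hW2m (fun w => sq_nonneg _) hCW2 hlag.le
  rw [sub_zero] at wG wQ
  rw [add_sub_cancel_left] at wP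
  -- the right-hand side `8 ∫ (h⁻¹ W)²`
  have hRW : ∫⁻ z, ENNReal.ofReal ((h⁻¹ * W z) ^ 2) ∂μ =
      ENNReal.ofReal (h⁻¹ ^ 2) * ∫⁻ z, ENNReal.ofReal (W z ^ 2) ∂μ := by
    rw [← lintegral_const_mul' _ _ ENNReal.ofReal_ne_top]
    refine lintegral_congr fun z => ?_
    rw [mul_pow, ENNReal.ofReal_mul (sq_nonneg _)]
  -- assemble
  calc ∫⁻ z, ENNReal.ofReal ((h⁻¹ * ∫ s in (0 : ℝ)..h, F (Φ.flow s z)) ^ 2) ∂μ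
      ≤ ∫⁻ z, (ENNReal.ofReal (2 * h⁻¹) * ENNReal.ofReal (∫ s in (0 : ℝ)..h, G (Φ.flow s z) ^ 2) +
          ENNReal.ofReal c * ENNReal.ofReal (∫ s in h..h + lag, W (Φ.flow s z) ^ 2) +
          ENNReal.ofReal c * ENNReal.ofReal (∫ s in (0 : ℝ)..lag, W (Φ.flow s z) ^ 2)) ∂μ :=
        lintegral_mono_ae hpt
    _ = ENNReal.ofReal (2 * h⁻¹) * ∫⁻ z, ENNReal.ofReal (∫ s in (0 : ℝ)..h, G (Φ.flow s z) ^ 2) ∂μ +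
          ENNReal.ofReal c * ∫⁻ z, ENNReal.ofReal (∫ s in h..h + lag, W (Φ.flow s z) ^ 2) ∂μ +
          ENNReal.ofReal c * ∫⁻ z, ENNReal.ofReal (∫ s in (0 : ℝ)..lag, W (Φ.flow s z) ^ 2) ∂μ := by
        rw [lintegral_add_left' hm12, lintegral_add_left' (hmG.const_mul _),
          lintegral_const_mul' _ _ ENNReal.ofReal_ne_top,
          lintegral_const_mul' _ _ ENNReal.ofReal_ne_top,
          lintegral_const_mul' _ _ ENNReal.ofReal_ne_top]
    _ = ENNReal.ofReal (2 * h⁻¹) * (ENNReal.ofReal h * ∫⁻ z, ENNReal.ofReal (G z ^ 2) ∂μ) +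
          ENNReal.ofReal c * (ENNReal.ofReal lag * ∫⁻ z, ENNReal.ofReal (W z ^ 2) ∂μ) +
          ENNReal.ofReal c * (ENNReal.ofReal lag * ∫⁻ z, ENNReal.ofReal (W z ^ 2) ∂μ) := by
        rw [wG, wP, wQ]
    _ = 2 * ∫⁻ z, ENNReal.ofReal (G z ^ 2) ∂μ +
          8 * (ENNReal.ofReal (h⁻¹ ^ 2) * ∫⁻ z, ENNReal.ofReal (W z ^ 2) ∂μ) := by
        have e2 : ENNReal.ofReal (2 * h⁻¹) * ENNReal.ofReal h = 2 := by
          rw [← ENNReal.ofReal_mul (by positivity),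
            show 2 * h⁻¹ * h = (2 : ℝ) by rw [mul_assoc, hinvh, mul_one], ENNReal.ofReal_ofNat]
        have e4 : ENNReal.ofReal c * ENNReal.ofReal lag = 4 * ENNReal.ofReal (h⁻¹ ^ 2) := by
          rw [← ENNReal.ofReal_mul hc0, hc,
            show 4 * h⁻¹ ^ 2 * lag⁻¹ * lag = 4 * h⁻¹ ^ 2 by rw [mul_assoc, hinvl, mul_one],
            ENNReal.ofReal_mul (by norm_num : (0 : ℝ) ≤ 4), ENNReal.ofReal_ofNat]
        simp only [← mul_assoc]
        rw [e2, e4]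
        ring
    _ = _ := by rw [hRW]

end Summit.AtomisticToContinuum.HydrodynamicLimit.Theorems

end
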